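import Summits.ValiantsHypothesis.ValiantsHypothesis.Theorems.LacunarySymmetroidMatrixDescartesOverlapWindowTwo
import Summits.ValiantsHypothesis.ValiantsHypothesis.Theorems.LacunarySymmetroidMatrixDescartesOverlapWindowRel

/-!
# `MatrixDescartes` — the two-survivor overlap window law in relative currency; the point certificate

HONEST FRAMING.  Object-search cell `pub-symmetroid`, crux `Theses.LacunarySymmetroid.MatrixDescartes` (ledger item
`stmt-ValiantsHypothesis-18050`, route `LacunarySymmetroid`; seat `val-sym-mdr-p2`, gen 13).  The crux implies `VP ≠ VNP`
by the route's assembly; NOTHING here is progress on it, and nothing here is a claim about `VP ≠ VNP`, `DoorA26` /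
`DoorA34` or the cell's registers.  Sequel of `…OverlapWindowTwo` / `…OverlapWindowRel`.

THE POINT CERTIFICATE (`tail_lt_survivor_of_rel`).  At a point `x > 0`, for a live set `L` and a letter `s ∈ L` with entry
bound `σ_s > 0` and conditioning `|det S s| ≥ η·σ_s^m`: if every live letter is `≤ M×` and every outside letter `≤ ε×` the
letter `σ_s·x^(d s)` at `x` (`0 ≤ ε ≤ M`), and the `|∏(e f − α)|`-weights of the non-live maps are at most `Ω` times the weight
`|∏(m·d s − α)| ≠ 0` of the pure power of `s`, then `m!·K^m·Ω·ε·M^(m−1) < η` makes the weighted non-live mass smaller than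
the `s`-survivor term at `x` — the endpoint inequality of all the window laws of this series, once and for all (real cuts).
THE TWO-SURVIVOR LAW IN RELATIVE CURRENCY (`card_roots_Icc_le_of_twoSurvivors_rel`): bottom survivor `b` certified at
`u` and at the split point `c`, top survivor `t` certified at `c` and `v`, parity as in `card_roots_Icc_le_of_twoSurvivors`
⇒ at most `#A` distinct zeros in `[u, v]`: ONE window per hand-over / tie-point cluster, in the currency an explicit family
proof needs (all hypotheses are monomial inequalities at three points plus one constant inequality).  ARBITRARY real letters.
[folklore] (Laguerre's method; Leibniz bounds).
-/

-- `Summit.ValiantsHypothesis.ValiantsHypothesis.…` repeats a component by the D-0017 layout (single-conjunct summit).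
set_option linter.dupNamespace false

namespace Summit.ValiantsHypothesis.ValiantsHypothesis.Theorems.LacunarySymmetroidMatrixDescartes.Overlap

open Polynomial Finset Set
open scoped BigOperators Matrix

variable {K m : ℕ}

/-! ## §14 The point certificate in relative currency (real cuts) -/

/-- **Point certificate.**  See the module docstring: at `x > 0`, live `≤ M×`, outside `≤ ε×` the letter `s`, weights `≤ Ω×`
the weight of `s`, conditioning `η`, and `m!·K^m·Ω·ε·M^(m−1) < η` ⇒ the weighted non-live mass is below the `s`-survivor
term. [folklore] -/
theorem tail_lt_survivor_of_rel (d : Fin K → ℕ) (S : Fin K → Matrix (Fin m) (Fin m) ℝ) (σ : Fin K → ℝ)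
    (hσ : ∀ l i j, |S l i j| ≤ σ l) (hσ0 : ∀ l, 0 ≤ σ l)
    (L : Finset (Fin K)) (s : Fin K) (hσs : 0 < σ s) (A : Finset ℝ)
    (hWs : ∏ α ∈ A, (((m * d s : ℕ) : ℝ) - α) ≠ 0)
    {η M ε Ω : ℝ} (hM0 : 0 ≤ M) (hε0 : 0 ≤ ε) (hεM : ε ≤ M) (hΩ0 : 0 ≤ Ω)
    (hdet : η * σ s ^ m ≤ |(S s).det|)
    (hweight : ∀ f : Fin m → Fin K, (¬ ∀ i, f i ∈ L) →
      |∏ α ∈ A, ((((∑ i, d (f i) : ℕ) : ℝ)) - α)| ≤ Ω * |∏ α ∈ A, (((m * d s : ℕ) : ℝ) - α)|)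
    (hconst : (m.factorial : ℝ) * (K : ℝ) ^ m * Ω * ε * M ^ (m - 1) < η)
    {x : ℝ} (hx : 0 < x)
    (hlive : ∀ k ∈ L, σ k * x ^ d k ≤ M * (σ s * x ^ d s))
    (hout : ∀ l ∉ L, σ l * x ^ d l ≤ ε * (σ s * x ^ d s)) :
    ∑ f ∈ Finset.univ.filter (fun f : Fin m → Fin K => ¬ ∀ i, f i ∈ L),
        |∏ α ∈ A, ((((∑ i, d (f i) : ℕ) : ℝ)) - α)| * |Matrix.det (Matrix.of fun i j => S (f i) i j)| *
          x ^ (∑ i, d (f i))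
      < |∏ α ∈ A, (((m * d s : ℕ) : ℝ) - α)| * |(S s).det| * x ^ (m * d s) := by
  classical
  set sv : ℝ := σ s * x ^ d s with hsv
  have hs0 : 0 < sv := mul_pos hσs (pow_pos hx _)
  set W : ℝ := |∏ α ∈ A, (((m * d s : ℕ) : ℝ) - α)| with hWdef
  have hW0 : 0 < W := abs_pos.2 hWs
  have hterm : ∀ f ∈ Finset.univ.filter (fun f : Fin m → Fin K => ¬ ∀ i, f i ∈ L),
      |∏ α ∈ A, ((((∑ i, d (f i) : ℕ) : ℝ)) - α)| * |Matrix.det (Matrix.of fun i j => S (f i) i j)| *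
        x ^ (∑ i, d (f i))
      ≤ Ω * W * ((m.factorial : ℝ) * (ε * M ^ (m - 1) * sv ^ m)) := by
    intro f hf
    rw [Finset.mem_filter] at hf
    obtain ⟨i₀, hi₀⟩ : ∃ i, f i ∉ L := by
      by_contra h; push Not at h; exact hf.2 h
    have hdetf := abs_det_rowChoice_le S σ hσ f
    have hprod : (∏ i, σ (f i)) * x ^ (∑ i, d (f i)) = ∏ i, (σ (f i) * x ^ d (f i)) := by
      rw [← Finset.prod_pow_eq_pow_sum, ← Finset.prod_mul_distrib]
    have hsmall : ∏ i, (σ (f i) * x ^ d (f i)) ≤ ε * M ^ (m - 1) * sv ^ m :=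
      prod_le_of_one_small (fun i => σ (f i) * x ^ d (f i)) (fun i => mul_nonneg (hσ0 _) (pow_nonneg hx.le _))
        hε0 hs0.le (fun i => by
          by_cases hiL : f i ∈ L
          · exact hlive (f i) hiL
          · exact (hout (f i) hiL).trans (mul_le_mul_of_nonneg_right hεM hs0.le)) i₀
        (hout (f i₀) hi₀)
    have h1 : |Matrix.det (Matrix.of fun i j => S (f i) i j)| * x ^ (∑ i, d (f i)) ≤
        (m.factorial : ℝ) * (ε * M ^ (m - 1) * sv ^ m) := by
      calc |Matrix.det (Matrix.of fun i j => S (f i) i j)| * x ^ (∑ i, d (f i))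
          ≤ ((m.factorial : ℝ) * ∏ i, σ (f i)) * x ^ (∑ i, d (f i)) :=
            mul_le_mul_of_nonneg_right hdetf (pow_nonneg hx.le _)
        _ = (m.factorial : ℝ) * ∏ i, (σ (f i) * x ^ d (f i)) := by rw [mul_assoc, hprod]
        _ ≤ (m.factorial : ℝ) * (ε * M ^ (m - 1) * sv ^ m) :=
            mul_le_mul_of_nonneg_left hsmall (Nat.cast_nonneg _)
    calc |∏ α ∈ A, ((((∑ i, d (f i) : ℕ) : ℝ)) - α)| * |Matrix.det (Matrix.of fun i j => S (f i) i j)| *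
          x ^ (∑ i, d (f i))
        = |∏ α ∈ A, ((((∑ i, d (f i) : ℕ) : ℝ)) - α)| *
            (|Matrix.det (Matrix.of fun i j => S (f i) i j)| * x ^ (∑ i, d (f i))) := by ring
      _ ≤ (Ω * W) * ((m.factorial : ℝ) * (ε * M ^ (m - 1) * sv ^ m)) :=
          mul_le_mul (hweight f hf.2) h1 (mul_nonneg (abs_nonneg _) (pow_nonneg hx.le _))
            (mul_nonneg hΩ0 hW0.le)
      _ = Ω * W * ((m.factorial : ℝ) * (ε * M ^ (m - 1) * sv ^ m)) := by ring
  have hcount : ((Finset.univ.filter (fun f : Fin m → Fin K => ¬ ∀ i, f i ∈ L)).card : ℝ) ≤ (K : ℝ) ^ m := by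
    have h := Finset.card_filter_le (Finset.univ : Finset (Fin m → Fin K)) (fun f => ¬ ∀ i, f i ∈ L)
    rw [Finset.card_univ, Fintype.card_fun, Fintype.card_fin, Fintype.card_fin] at h
    exact_mod_cast h
  have hsum := Finset.sum_le_sum hterm
  rw [Finset.sum_const, nsmul_eq_mul] at hsum
  have hrhs : W * |(S s).det| * x ^ (m * d s) ≥ W * (η * sv ^ m) := by
    have : η * sv ^ m = η * σ s ^ m * x ^ (m * d s) := by
      rw [hsv, mul_pow, ← pow_mul, mul_comm (d s) m]; ring
    rw [this, ← mul_assoc]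
    exact mul_le_mul_of_nonneg_right (mul_le_mul_of_nonneg_left hdet hW0.le) (pow_nonneg hx.le _)
  have hnonneg : 0 ≤ Ω * W * ((m.factorial : ℝ) * (ε * M ^ (m - 1) * sv ^ m)) := by positivity
  calc ∑ f ∈ Finset.univ.filter (fun f : Fin m → Fin K => ¬ ∀ i, f i ∈ L),
        |∏ α ∈ A, ((((∑ i, d (f i) : ℕ) : ℝ)) - α)| * |Matrix.det (Matrix.of fun i j => S (f i) i j)| *
          x ^ (∑ i, d (f i))
      ≤ ((Finset.univ.filter (fun f : Fin m → Fin K => ¬ ∀ i, f i ∈ L)).card : ℝ) *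
          (Ω * W * ((m.factorial : ℝ) * (ε * M ^ (m - 1) * sv ^ m))) := hsum
    _ ≤ (K : ℝ) ^ m * (Ω * W * ((m.factorial : ℝ) * (ε * M ^ (m - 1) * sv ^ m))) :=
        mul_le_mul_of_nonneg_right hcount hnonneg
    _ = ((m.factorial : ℝ) * (K : ℝ) ^ m * Ω * ε * M ^ (m - 1)) * (W * sv ^ m) := by ring
    _ < η * (W * sv ^ m) := mul_lt_mul_of_pos_right hconst (mul_pos hW0 (pow_pos hs0 _))
    _ = W * (η * sv ^ m) := by ring
    _ ≤ W * |(S s).det| * x ^ (m * d s) := hrhs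

/-! ## §15 The two-survivor law in relative currency -/

/-- **TWO-SURVIVOR OVERLAP WINDOW LAW, relative currency.**  Window `[u, v] ∋ c` (`0 < u ≤ c ≤ v`), live set `L`,
survivors `b ≠ t` in `L` (`σ_b, σ_t > 0`, conditioning `η`), real cuts `A` killing every other live exponent, the two pure
weights non-zero, PARITY `0 ≤ det S b·∏(m d b − α)·det S t·∏(m d t − α)`, weight ratios `≤ Ω` against BOTH survivor weights,
`m!·K^m·Ω·ε·M^(m−1) < η`, and the monomial inequalities: at `x = u` and `x = c` relative to `b`, at `x = c` and `x = v`
relative to `t` (live `≤ M×`, outside `≤ ε×`).  Then `det F` has at most `#A` distinct zeros in `[u, v]`. [folklore] -/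
theorem card_roots_Icc_le_of_twoSurvivors_rel (d : Fin K → ℕ) (S : Fin K → Matrix (Fin m) (Fin m) ℝ)
    (σ : Fin K → ℝ) (hσ : ∀ l i j, |S l i j| ≤ σ l) (hσ0 : ∀ l, 0 ≤ σ l)
    (L : Finset (Fin K)) (b t : Fin K) (hb : b ∈ L) (ht : t ∈ L) (hbt : b ≠ t) (hσb : 0 < σ b) (hσt : 0 < σ t)
    (A : Finset ℝ)
    (hA : ∀ f : Fin m → Fin K, (∀ i, f i ∈ L) → (∃ i, f i ≠ b) → (∃ i, f i ≠ t) →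
      (((∑ i, d (f i) : ℕ) : ℝ)) ∈ A)
    (hWb : ∏ α ∈ A, (((m * d b : ℕ) : ℝ) - α) ≠ 0) (hWt : ∏ α ∈ A, (((m * d t : ℕ) : ℝ) - α) ≠ 0)
    (hsign : 0 ≤ ((S b).det * ∏ α ∈ A, (((m * d b : ℕ) : ℝ) - α)) *
      ((S t).det * ∏ α ∈ A, (((m * d t : ℕ) : ℝ) - α)))
    {η M ε Ω : ℝ} (hM0 : 0 ≤ M) (hε0 : 0 ≤ ε) (hεM : ε ≤ M) (hΩ0 : 0 ≤ Ω)
    (hdetb : η * σ b ^ m ≤ |(S b).det|) (hdett : η * σ t ^ m ≤ |(S t).det|)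
    (hweightb : ∀ f : Fin m → Fin K, (¬ ∀ i, f i ∈ L) →
      |∏ α ∈ A, ((((∑ i, d (f i) : ℕ) : ℝ)) - α)| ≤ Ω * |∏ α ∈ A, (((m * d b : ℕ) : ℝ) - α)|)
    (hweightt : ∀ f : Fin m → Fin K, (¬ ∀ i, f i ∈ L) →
      |∏ α ∈ A, ((((∑ i, d (f i) : ℕ) : ℝ)) - α)| ≤ Ω * |∏ α ∈ A, (((m * d t : ℕ) : ℝ) - α)|)
    (hconst : (m.factorial : ℝ) * (K : ℝ) ^ m * Ω * ε * M ^ (m - 1) < η)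
    {u c v : ℝ} (hu : 0 < u) (huc : u ≤ c) (hcv : c ≤ v)
    (hliveb : ∀ x : ℝ, (x = u ∨ x = c) → ∀ k ∈ L, σ k * x ^ d k ≤ M * (σ b * x ^ d b))
    (houtb : ∀ x : ℝ, (x = u ∨ x = c) → ∀ l ∉ L, σ l * x ^ d l ≤ ε * (σ b * x ^ d b))
    (hlivet : ∀ x : ℝ, (x = c ∨ x = v) → ∀ k ∈ L, σ k * x ^ d k ≤ M * (σ t * x ^ d t))
    (houtt : ∀ x : ℝ, (x = c ∨ x = v) → ∀ l ∉ L, σ l * x ^ d l ≤ ε * (σ t * x ^ d t)) :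
    ((Matrix.det (∑ l, ((X : ℝ[X]) ^ d l) • (S l).map C)).roots.toFinset.filter
        (fun x => x ∈ Icc u v)).card ≤ A.card := by
  have hc : 0 < c := hu.trans_le huc
  refine card_roots_Icc_le_of_twoSurvivors d S L b t hb ht hbt A hA hsign hu huc hcv
    (fun x hx => ?_) (fun x hx => ?_)
  · have hx0 : 0 < x := by rcases hx with rfl | rfl; exact hu; exact hc
    exact tail_lt_survivor_of_rel d S σ hσ hσ0 L b hσb A hWb hM0 hε0 hεM hΩ0 hdetb hweightb hconst hx0
      (hliveb x hx) (houtb x hx)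
  · have hx0 : 0 < x := by rcases hx with rfl | rfl; exact hc; exact hc.trans_le hcv
    exact tail_lt_survivor_of_rel d S σ hσ hσ0 L t hσt A hWt hM0 hε0 hεM hΩ0 hdett hweightt hconst hx0
      (hlivet x hx) (houtt x hx)

end Summit.ValiantsHypothesis.ValiantsHypothesis.Theorems.LacunarySymmetroidMatrixDescartes.Overlap
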